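import Mathlib
import HarnessLib
import Literature.Analysis.FluidPDE.VectorCalculus
import Literature.Analysis.FluidPDE.VectorCalculusProofs
import Literature.Analysis.FluidPDE.VorticityStretching
import Literature.Analysis.FluidPDE.AncientSimilarityVorticity
import Summits.NavierStokesRegularity.NavierStokesRegularity.Theorems.LocalSineTubeDoorLocalPointZoomHessSlices
import Summits.NavierStokesRegularity.NavierStokesRegularity.Theorems.LocalSineTubeDoorWindowFatouSecondOrder
import Summits.NavierStokesRegularity.NavierStokesRegularity.Theorems.LocalSineTubeDoorProfileAlignedWindowRigidityAncient
import Summits.NavierStokesRegularity.NavierStokesRegularity.Theorems.LocalLambTubeDoorGeneralisedBeltramiProfileRigidity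

/-!
# The one-window door family — THE `curl (u × ω)` DOOR (generalised Beltrami; second order), unconditional

Cell ns-regularity-ideate, seat p6 (route-directed support for nsreg-p1's door family; anchor
`--supports stmt-NavierStokesRegularity-20017`; rung N0-LocalTubeDoorSine neighbourhood).  The SECOND-ORDER companion
of the Lamb-vector door `…LocalLambTubeDoorTarget.localTubeDoorLamb`: the window scalar is the curl of the Lamb vector,
`curl (u × ω) = (ω·∇)u − (u·∇)ω` (`ω = curl u`, `div u = 0`) — the quantity whose vanishing makes the vorticity equation
the HEAT EQUATION.  Result (`localTubeDoorCurlLamb`, and `localTubeDoorCurlLamb'` with the scalar written as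
`curl (u × curl u)`):

  for a classical Leray–Hopf solution on `[0,T)` from rapidly decaying data that is LOCALLY Type I at `(x₀, T)`, if
  `∫_U (T−t)² ‖((ω·∇)u − (u·∇)ω)(t, x₀ + √(T−t) y)‖ dy → 0` as `t → T⁻` over ONE nonempty open similarity window `U`,
  then `u` stays bounded near `x₀` up to `T` (`IsBackwardBoundedAt u T x₀`).

(`(T−t)²` is the scale-invariant normalisation; the hypothesis is implied by, and strictly weaker than, that of the
Lamb-vector door.)  Assembly: the universal second-order zoom `…LocalPointZoomHessSlices.localPointZoomVelGradHessSlices`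
(p444934), the second-order window Fatou lemma `…WindowFatouSecondOrder.windowFatou_secondOrder` (p444763) with the
scalar `F(x, A, B) = ‖A (curlCLM A) − Σⱼ eⱼ × B[x, eⱼ]‖` (for `A = Du(z)`, `B = D²u(z)`, `x = u(z)` this is
`‖(ω·∇)u − (u·∇)ω‖(z)`, `curlCLM L = Σⱼ eⱼ × L eⱼ`), whose MIXED homogeneity `F(ax, bA, cB) = ‖b²·P − ac·Q‖` is matched
by the zoom's scalings `(a, b, c) = (σν, σ²ν, σ³ν)` (`b² = ac`; the generic template `genericDoor2_…` asks for separate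
invariance and does not apply verbatim), and the PROVED profile window crux
`…LocalLambTubeDoorGeneralisedBeltramiProfileRigidity.generalisedBeltramiWindowRigidity`.

* `curlCLM_eq_sum_cross` — `curlCLM L = Σⱼ eⱼ × L eⱼ`;
* `sum_cross_iteratedFDeriv_eq` — `Σⱼ eⱼ × D²u(z)[w, eⱼ] = D(curl u)(z)[w]` for `u ∈ C²`;
* `continuous_curlLambScalar`, `curlLambScalar_smul` — continuity and mixed homogeneity of `F`;
* `localTubeDoorCurlLamb`, `localTubeDoorCurlLamb'` — the door.

WHAT THIS IS NOT: not a claim about Navier–Stokes regularity (Clay A) — a LOCAL regularity CRITERION conditional on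
local Type I (bears_on LADDER-NS N0); establishment in the cell's sense needs the cross-family referee PASS +
independent reproduction.
-/

noncomputable section

-- the summit and its single sub-problem share the name (CONVENTIONS §1), as in every Theorems file
set_option linter.dupNamespace false

namespace Summit.NavierStokesRegularity.NavierStokesRegularity.Theorems.LocalLambTubeDoorCurlLambTarget

open MeasureTheory Set Function Filter Topology TopologicalSpace Metric
open scoped RealInnerProductSpace InnerProductSpace NNReal ENNReal
open Literature.Analysis Literature.Analysis.FluidPDE
open Summit.NavierStokesRegularity.NavierStokesRegularity.Theorems.LocalSineTubeDoorLocalPointZoomHessSlices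
open Summit.NavierStokesRegularity.NavierStokesRegularity.Theorems.LocalSineTubeDoorWindowFatouSecondOrder
open Summit.NavierStokesRegularity.NavierStokesRegularity.Theorems.LocalSineTubeDoorProfileAlignedWindowRigidityAncient
open Summit.NavierStokesRegularity.NavierStokesRegularity.Theorems.LocalLambTubeDoorGeneralisedBeltramiProfileRigidity

/-! ### curl algebra: `curlCLM L = Σⱼ eⱼ × L eⱼ` and the directional derivative of the vorticity -/

/-- **`curlCLM L = Σⱼ eⱼ × (L eⱼ)`** (the identity `∇ × u = Σⱼ eⱼ × ∂ⱼu` at the level of the Jacobian). -/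
theorem curlCLM_eq_sum_cross (L : EuclideanSpace ℝ (Fin 3) →L[ℝ] EuclideanSpace ℝ (Fin 3)) :
    curlCLM L = ∑ j : Fin 3, cross (EuclideanSpace.single j (1 : ℝ)) (L (EuclideanSpace.single j (1 : ℝ))) := by
  ext i
  fin_cases i <;> simp [curlCLM_apply, cross, cross_apply, Fin.sum_univ_three] <;> ring

/-- **The directional derivative of the vorticity from the Hessian**: for `u ∈ C²` near `z`,
`Σⱼ eⱼ × D²u(z)[w, eⱼ] = D(curl u)(z)[w]`. -/
theorem sum_cross_iteratedFDeriv_eq {u : EuclideanSpace ℝ (Fin 3) → EuclideanSpace ℝ (Fin 3)}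
    {z : EuclideanSpace ℝ (Fin 3)} (hu : ContDiffAt ℝ 2 u z) (w : EuclideanSpace ℝ (Fin 3)) :
    ∑ j : Fin 3, cross (EuclideanSpace.single j (1 : ℝ)) (iteratedFDeriv ℝ 2 u z ![w, EuclideanSpace.single j (1 : ℝ)]) =
      fderiv ℝ (curl u) z w := by
  have hd : DifferentiableAt ℝ (fderiv ℝ u) z := (hu.fderiv_right (m := 1) le_rfl).differentiableAt one_ne_zero
  have hD : fderiv ℝ (curl u) z = curlCLM.comp (fderiv ℝ (fderiv ℝ u) z) := by
    rw [curl_eq_curlCLM_comp]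
    exact (curlCLM.hasFDerivAt.comp z hd.hasFDerivAt).fderiv
  rw [hD, ContinuousLinearMap.comp_apply, curlCLM_eq_sum_cross]
  refine Finset.sum_congr rfl fun j _ => ?_
  rw [iteratedFDeriv_two_apply]
  simp

/-! ### the window scalar `F(x, A, B) = ‖A (curlCLM A) − Σⱼ eⱼ × B[x, eⱼ]‖` -/

/-- `B[a x, y] = a B[x, y]` for a continuous bilinear map on `ℝ³` (multilinearity in the first slot). -/
theorem cmm_smul_left (B : ContinuousMultilinearMap ℝ (fun _ : Fin 2 => EuclideanSpace ℝ (Fin 3)) (EuclideanSpace ℝ (Fin 3)))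
    (a : ℝ) (x y : EuclideanSpace ℝ (Fin 3)) : B ![a • x, y] = a • B ![x, y] := by
  have h1 : (![a • x, y] : Fin 2 → EuclideanSpace ℝ (Fin 3)) = Function.update ![x, y] 0 (a • x) := by
    funext i; fin_cases i <;> simp
  have h2 : (![x, y] : Fin 2 → EuclideanSpace ℝ (Fin 3)) = Function.update ![x, y] 0 x := by
    funext i; fin_cases i <;> simp
  rw [h1, B.map_update_smul, ← h2]

/-- The scalar `F(x, A, B) = ‖A (curlCLM A) − Σⱼ eⱼ × B[x, eⱼ]‖` is continuous in `(x, A, B)`. -/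
theorem continuous_curlLambScalar :
    Continuous fun q : EuclideanSpace ℝ (Fin 3) × (EuclideanSpace ℝ (Fin 3) →L[ℝ] EuclideanSpace ℝ (Fin 3)) ×
      ContinuousMultilinearMap ℝ (fun _ : Fin 2 => EuclideanSpace ℝ (Fin 3)) (EuclideanSpace ℝ (Fin 3)) =>
      ‖q.2.1 (curlCLM q.2.1) - ∑ j : Fin 3, cross (EuclideanSpace.single j (1 : ℝ))
        (q.2.2 ![q.1, EuclideanSpace.single j (1 : ℝ)])‖ := by
  refine continuous_norm.comp (Continuous.sub ?_ (continuous_finsetSum _ fun j _ => ?_))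
  · have hA : Continuous fun q : EuclideanSpace ℝ (Fin 3) × (EuclideanSpace ℝ (Fin 3) →L[ℝ] EuclideanSpace ℝ (Fin 3)) ×
        ContinuousMultilinearMap ℝ (fun _ : Fin 2 => EuclideanSpace ℝ (Fin 3)) (EuclideanSpace ℝ (Fin 3)) => q.2.1 :=
      continuous_fst.comp continuous_snd
    exact isBoundedBilinearMap_apply.continuous.comp (hA.prodMk (curlCLM.continuous.comp hA))
  · have hB : Continuous fun q : EuclideanSpace ℝ (Fin 3) × (EuclideanSpace ℝ (Fin 3) →L[ℝ] EuclideanSpace ℝ (Fin 3)) ×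
        ContinuousMultilinearMap ℝ (fun _ : Fin 2 => EuclideanSpace ℝ (Fin 3)) (EuclideanSpace ℝ (Fin 3)) => q.2.2 :=
      continuous_snd.comp continuous_snd
    have hm : Continuous fun q : EuclideanSpace ℝ (Fin 3) × (EuclideanSpace ℝ (Fin 3) →L[ℝ] EuclideanSpace ℝ (Fin 3)) ×
        ContinuousMultilinearMap ℝ (fun _ : Fin 2 => EuclideanSpace ℝ (Fin 3)) (EuclideanSpace ℝ (Fin 3)) =>
        (![q.1, EuclideanSpace.single j (1 : ℝ)] : Fin 2 → EuclideanSpace ℝ (Fin 3)) :=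
      continuous_pi fun i => by
        refine Fin.cases ?_ (fun k => ?_) i
        · simpa using continuous_fst
        · simpa using continuous_const
    have hev := continuous_eval.comp (hB.prodMk hm)
    simpa only [Function.comp_def, crossCLM_apply] using (crossCLM (EuclideanSpace.single j (1 : ℝ))).continuous.comp hev

/-- **Mixed homogeneity** of the scalar: `F(a x, b A, c B) = ‖b² (A (curlCLM A)) − (a c) Σⱼ eⱼ × B[x, eⱼ]‖`. -/
theorem curlLambScalar_smul (a b c : ℝ) (x : EuclideanSpace ℝ (Fin 3))
    (A : EuclideanSpace ℝ (Fin 3) →L[ℝ] EuclideanSpace ℝ (Fin 3))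
    (B : ContinuousMultilinearMap ℝ (fun _ : Fin 2 => EuclideanSpace ℝ (Fin 3)) (EuclideanSpace ℝ (Fin 3))) :
    (b • A) (curlCLM (b • A)) - ∑ j : Fin 3, cross (EuclideanSpace.single j (1 : ℝ))
        ((c • B) ![a • x, EuclideanSpace.single j (1 : ℝ)]) =
      (b ^ 2) • A (curlCLM A) - (a * c) • ∑ j : Fin 3, cross (EuclideanSpace.single j (1 : ℝ))
        (B ![x, EuclideanSpace.single j (1 : ℝ)]) := by
  have h1 : (b • A) (curlCLM (b • A)) = (b ^ 2) • A (curlCLM A) := by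
    rw [map_smul, _root_.smul_apply, map_smul, smul_smul, sq]
  have h2 : ∀ j : Fin 3, cross (EuclideanSpace.single j (1 : ℝ)) ((c • B) ![a • x, EuclideanSpace.single j (1 : ℝ)]) =
      (a * c) • cross (EuclideanSpace.single j (1 : ℝ)) (B ![x, EuclideanSpace.single j (1 : ℝ)]) := by
    intro j
    rw [_root_.smul_apply, cmm_smul_left, smul_smul, ← crossCLM_apply, map_smul, crossCLM_apply,
      mul_comm]
  rw [h1, Finset.smul_sum]
  congr 1
  exact Finset.sum_congr rfl fun j _ => h2 j

/-! ### the door -/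

/-- **THE `curl (u × ω)` DOOR — unconditional** (stretching-minus-transport form).  A classical Leray–Hopf solution on
`[0,T)` from rapidly decaying data, LOCALLY Type I at `(x₀,T)`, for which
`∫_U (T−t)² ‖Du(ω) − Dω(u)‖(t, x₀ + √(T−t)y) dy → 0` as `t → T⁻` over one nonempty open similarity window `U`
(`ω = curl u`; the integrand is `(T−t)² ‖curl (u × ω)‖`), is backward bounded at `x₀`. -/
theorem localTubeDoorCurlLamb :
    ∀ (ν T : ℝ), 0 < ν → 0 < T → ∀ (u : ℝ → EuclideanSpace ℝ (Fin 3) → EuclideanSpace ℝ (Fin 3))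
      (p : ℝ → EuclideanSpace ℝ (Fin 3) → ℝ),
    Literature.Analysis.FluidPDE.IsClassicalNSSolutionOn (Set.Ico 0 T) ν 0 u p →
    Literature.Analysis.FluidPDE.IsLerayHopfOn T ν 0 (u 0) u →
    Literature.Analysis.FluidPDE.HasRapidSpatialDecay (u 0) →
    ∀ (x₀ : EuclideanSpace ℝ (Fin 3)) (ρ M : ℝ), 0 < ρ →
    (∀ t ∈ Set.Ico 0 T, T - ρ ^ 2 < t → ∀ x ∈ Metric.ball x₀ ρ, ‖u t x‖ * Real.sqrt (ν * (T - t)) ≤ M) →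
    ∀ (U : Set (EuclideanSpace ℝ (Fin 3))), IsOpen U → U.Nonempty →
    Filter.Tendsto (fun t => ∫⁻ y in U, ENNReal.ofReal
      ((T - t) ^ 2 * ‖fderiv ℝ (u t) (x₀ + Real.sqrt (T - t) • y)
          (Literature.Analysis.FluidPDE.curl (u t) (x₀ + Real.sqrt (T - t) • y)) -
        fderiv ℝ (Literature.Analysis.FluidPDE.curl (u t)) (x₀ + Real.sqrt (T - t) • y)
          (u t (x₀ + Real.sqrt (T - t) • y))‖))
      (nhdsWithin T (Set.Iio T)) (nhds 0) →
    Literature.Analysis.FluidPDE.IsBackwardBoundedAt u T x₀ := by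
  intro ν T hν hT u p hcl hLH hdec x₀ ρ M hρ hM U hU hUne hfade
  -- the window scalar
  set F : EuclideanSpace ℝ (Fin 3) → (EuclideanSpace ℝ (Fin 3) →L[ℝ] EuclideanSpace ℝ (Fin 3)) →
      ContinuousMultilinearMap ℝ (fun _ : Fin 2 => EuclideanSpace ℝ (Fin 3)) (EuclideanSpace ℝ (Fin 3)) → ℝ :=
    fun x A B => ‖A (curlCLM A) - ∑ j : Fin 3, cross (EuclideanSpace.single j (1 : ℝ))
      (B ![x, EuclideanSpace.single j (1 : ℝ)])‖ with hFdef
  have hF : Continuous fun q : EuclideanSpace ℝ (Fin 3) × (EuclideanSpace ℝ (Fin 3) →L[ℝ] EuclideanSpace ℝ (Fin 3)) ×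
      ContinuousMultilinearMap ℝ (fun _ : Fin 2 => EuclideanSpace ℝ (Fin 3)) (EuclideanSpace ℝ (Fin 3)) =>
      F q.1 q.2.1 q.2.2 := continuous_curlLambScalar
  -- identification of the scalar on an honest `C²` field: `F(u z, Du z, D²u z) = ‖Du(ω) − Dω(u)‖(z)`
  have hident : ∀ {w : EuclideanSpace ℝ (Fin 3) → EuclideanSpace ℝ (Fin 3)} {z : EuclideanSpace ℝ (Fin 3)},
      ContDiffAt ℝ 2 w z → ∀ a b c : ℝ,
      F (a • w z) (b • fderiv ℝ w z) (c • iteratedFDeriv ℝ 2 w z) =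
        ‖(b ^ 2) • fderiv ℝ w z (curl w z) - (a * c) • fderiv ℝ (curl w) z (w z)‖ := by
    intro w z hw a b c
    simp only [hFdef]
    rw [curlLambScalar_smul, sum_cross_iteratedFDeriv_eq hw, ← curl_eq_curlCLM]
  -- the fading hypothesis in `F`-form
  have hfadeF : Tendsto (fun t => ∫⁻ y in U, ENNReal.ofReal
      |F (Real.sqrt (T - t) • u t (x₀ + Real.sqrt (T - t) • y))
        (Real.sqrt (T - t) ^ 2 • fderiv ℝ (u t) (x₀ + Real.sqrt (T - t) • y))
        (Real.sqrt (T - t) ^ 3 • iteratedFDeriv ℝ 2 (u t) (x₀ + Real.sqrt (T - t) • y))|) (𝓝[<] T) (𝓝 0) := by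
    have hev : ∀ᶠ t in 𝓝[<] T, t ∈ Ioo 0 T := Ioo_mem_nhdsLT hT
    refine hfade.congr' (hev.mono fun t ht => ?_)
    refine lintegral_congr fun y => ?_
    have hs : 0 ≤ T - t := (sub_pos.2 ht.2).le
    have hC2 : ContDiffAt ℝ 2 (u t) (x₀ + Real.sqrt (T - t) • y) :=
      ((hcl.contDiff_velocity ⟨ht.1.le, ht.2⟩).of_le (by norm_cast)).contDiffAt
    rw [hident hC2, abs_of_nonneg (norm_nonneg _)]
    have e1 : (Real.sqrt (T - t) ^ 2) ^ 2 = (T - t) ^ 2 := by rw [Real.sq_sqrt hs]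
    have e2 : Real.sqrt (T - t) * Real.sqrt (T - t) ^ 3 = (T - t) ^ 2 := by
      rw [← pow_succ', show (3 + 1 : ℕ) = 2 * 2 from rfl, pow_mul, Real.sq_sqrt hs]
    rw [e1, e2, ← smul_sub, norm_smul, Real.norm_eq_abs, abs_of_nonneg (sq_nonneg _)]
  -- the zoom and the profile crux
  by_contra hnot
  obtain ⟨C, v, lam, hlam, hlam0, ⟨hrate, hcont, hmild, hdiv⟩, hsing, hconv⟩ :=
    localPointZoomVelGradHessSlices ν T hν hT u p hcl hLH hdec x₀ ρ M hρ hM hnot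
  refine generalisedBeltramiWindowRigidity C v hrate hcont hmild hdiv (fun s hs => ?_) hsing
  have hns : 0 < -s := neg_pos.2 hs
  set σ : ℝ := Real.sqrt (-s) / Real.sqrt ν with hσ
  have hσpos : 0 < σ := div_pos (Real.sqrt_pos.2 hns) (Real.sqrt_pos.2 hν)
  refine ⟨(fun z => σ⁻¹ • z) ⁻¹' U, hU.preimage (continuous_const_smul σ⁻¹), ?_, fun z hz => ?_⟩
  · obtain ⟨u₀, hu₀⟩ := hUne
    refine ⟨σ • u₀, ?_⟩
    show σ⁻¹ • (σ • u₀) ∈ U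
    rwa [smul_smul, inv_mul_cancel₀ hσpos.ne', one_smul]
  · have hy : σ⁻¹ • z ∈ U := hz
    have key := windowFatou_secondOrder hν hT hcl hlam hlam0 hrate hcont hmild hconv F hF hU hfadeF hs hy
    have hzz : σ • (σ⁻¹ • z) = z := by rw [smul_smul, mul_inv_cancel₀ hσpos.ne', one_smul]
    rw [← hσ, hzz] at key
    have hC2 : ContDiffAt ℝ 2 (v s) z :=
      ((analyticOnNhd_slice hcont (bdd_of_hasTypeITimeDecay hrate) hmild hs).contDiff.of_le (by norm_cast)).contDiffAt
    rw [hident hC2, norm_eq_zero] at key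
    have hbc : (σ ^ 2 * ν) ^ 2 = σ * ν * (σ ^ 3 * ν) := by ring
    rw [hbc, ← smul_sub, smul_eq_zero] at key
    rcases key with h0 | h0
    · exfalso
      have : 0 < σ * ν * (σ ^ 3 * ν) := by positivity
      exact this.ne' h0
    · exact sub_eq_zero.1 h0

/-- **THE `curl (u × ω)` DOOR — unconditional** (curl-of-the-Lamb-vector form): the same criterion with the window
scalar written as `(T−t)² ‖curl (u × curl u)‖` (`curl (u × ω) = Du(ω) − Dω(u)` for divergence-free `u`, tree
`curl_cross_apply`). -/
theorem localTubeDoorCurlLamb' :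
    ∀ (ν T : ℝ), 0 < ν → 0 < T → ∀ (u : ℝ → EuclideanSpace ℝ (Fin 3) → EuclideanSpace ℝ (Fin 3))
      (p : ℝ → EuclideanSpace ℝ (Fin 3) → ℝ),
    Literature.Analysis.FluidPDE.IsClassicalNSSolutionOn (Set.Ico 0 T) ν 0 u p →
    Literature.Analysis.FluidPDE.IsLerayHopfOn T ν 0 (u 0) u →
    Literature.Analysis.FluidPDE.HasRapidSpatialDecay (u 0) →
    ∀ (x₀ : EuclideanSpace ℝ (Fin 3)) (ρ M : ℝ), 0 < ρ →
    (∀ t ∈ Set.Ico 0 T, T - ρ ^ 2 < t → ∀ x ∈ Metric.ball x₀ ρ, ‖u t x‖ * Real.sqrt (ν * (T - t)) ≤ M) →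
    ∀ (U : Set (EuclideanSpace ℝ (Fin 3))), IsOpen U → U.Nonempty →
    Filter.Tendsto (fun t => ∫⁻ y in U, ENNReal.ofReal
      ((T - t) ^ 2 * ‖Literature.Analysis.FluidPDE.curl
        (fun x => Literature.Analysis.FluidPDE.cross (u t x) (Literature.Analysis.FluidPDE.curl (u t) x))
        (x₀ + Real.sqrt (T - t) • y)‖))
      (nhdsWithin T (Set.Iio T)) (nhds 0) →
    Literature.Analysis.FluidPDE.IsBackwardBoundedAt u T x₀ := by
  intro ν T hν hT u p hcl hLH hdec x₀ ρ M hρ hM U hU hUne hfade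
  refine localTubeDoorCurlLamb ν T hν hT u p hcl hLH hdec x₀ ρ M hρ hM U hU hUne ?_
  have hev : ∀ᶠ t in 𝓝[<] T, t ∈ Ioo 0 T := Ioo_mem_nhdsLT hT
  refine hfade.congr' (hev.mono fun t ht => ?_)
  refine lintegral_congr fun y => ?_
  congr 2
  set z := x₀ + Real.sqrt (T - t) • y with hz
  have hC : ContDiff ℝ 2 (u t) := (hcl.contDiff_velocity ⟨ht.1.le, ht.2⟩).of_le (by norm_cast)
  have hud : DifferentiableAt ℝ (u t) z := (hC.differentiable (by norm_num)).differentiableAt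
  have hωC : ContDiff ℝ 1 (curl (u t)) := contDiff_curl (n := 1) (by exact_mod_cast hC)
  have hωd : DifferentiableAt ℝ (curl (u t)) z := (hωC.differentiable one_ne_zero).differentiableAt
  rw [curl_cross_apply hud hωd, hcl.divFree t ⟨ht.1.le, ht.2⟩ z, divergence_curl_eq_zero_holds (u t) hC z, zero_smul,
    zero_smul, sub_zero, add_zero]

end Summit.NavierStokesRegularity.NavierStokesRegularity.Theorems.LocalLambTubeDoorCurlLambTarget

end
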